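import Literature.Geometry.Kaehler.ComplexTorusKleimanFormsHodgeRiemann
import Literature.Geometry.Kaehler.ComplexTorusHodgeClassesDimension
import Mathlib.LinearAlgebra.BilinearForm.Orthogonal
import HarnessLib

/-!
# André's form ON THE HODGE CLASSES: the rational bilinear form `⟨x, y⟩_H = B_e(x, *_H y)` on `Hdgᵖ(X) ⊂ H^{2p}(X; ℚ)` of a complex torus —
# symmetric, and for a polarized torus DEFINITE up to the sign `sign_X(e)(−1)^g`, hence anisotropic, non-degenerate on EVERY subspace, and
# EVERY SUBSPACE `A ≤ Hdgᵖ(X)` HAS ITS `⟨·,·⟩_H`-ORTHOGONAL COMPLEMENT: `Hdgᵖ(X) = A ⊕ A^⊥` (the semisimplicity mechanism); the same for Kleiman's `∗`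

Layer `Literature/Geometry/Kaehler`, namespace `Literature.Geometry.Kaehler.ComplexTorus`; lane `lit-hodgefound` (Track 2 foundations library),
prover seat `lit-hodgefound-p35` (generation 51, row g51-#9; sequel of rows g51-#5 `ComplexTorusKleimanFormsAndre` and g51-#6 `ComplexTorusKleimanFormsHodgeRiemann` —
`K_H = B_e(·, *_H ·)`, `K_∗ = B_e(·, ∗ ·)` are `ℚ`-valued on rational classes and `sign_X(e)(−1)^g K(x, x) ∈ ℚ_{>0}` on `Hdgᵖ(X) ∖ 0` — and of `ComplexTorusHodgeClassesDimension`
(`dim_ℚ Hdgᵖ(X) < ∞`)). TWO DEFINITIONS WITH BODIES (`hodgeClassesToGForm`, `andreFormHodgeClasses`; plus `kleimanFormHodgeClasses`) AND THEOREMS; no named fact, no instance,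
no notation; D-0026 net debt `0`.

THE POINT. André's use of `*_H` (and Kleiman's of `⋆`) in the theory of motivated / algebraic cycles rests on ONE structural fact: on the `ℚ`-space of cycles the form
`(x, y) ↦ ⟨x, *_H y⟩` is symmetric and (sign-)definite, so every sub-object has an orthogonal complement and the relevant algebras are semisimple ("la forme […] est définie
[…] d'où la semi-simplicité"). On a polarized complex torus the `ℚ`-space of Hodge classes `Hdgᵖ(X) = H^{2p}(X; ℚ) ∩ H^{p,p}` carries this structure UNCONDITIONALLY: THIS FILE packages
`⟨x, y⟩_H := B_e(of x, *_H (of y)) ∈ ℚ` as a `LinearMap.BilinForm ℚ (hodgeClasses Φ p)` and proves: symmetric (reflexive), `0 < sign_X(e)(−1)^g ⟨x, x⟩_H` for `x ≠ 0`, anisotropic,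
non-degenerate on every `ℚ`-subspace `A`, and — Mathlib's `isCompl_orthogonal_of_restrict_nondegenerate` on the finite-dimensional `Hdgᵖ(X)` — **`IsCompl A A^{⊥_H}`**: every subspace of
Hodge classes is complemented by its André-orthogonal. The same six facts for Kleiman's `⟨x, ∗y⟩`.

## What is proved (`η ∈ NS(X) ⊗ ℚ` non-degenerate — `hQ`, `hη` — for the definitions; `η` a Riemann form — `hR` — for positivity; `e : Fin N ≃ ι`, resp. `e : Fin (2g) ≃ ι`)

* §1 **def `hodgeClassesToGForm Φ p : hodgeClasses Φ p →ₗ[ℚ] GForm E ℂ`** (`x ↦ of (2p) x`), `hodgeClassesToGForm_apply`, `hodgeClassesToGForm_injective`;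
  **def `andreFormHodgeClasses Φ hQ hη e p : LinearMap.BilinForm ℚ (hodgeClasses Φ p)`** (`⟨x, y⟩_H`, normalisation `d = g`), **`coe_andreFormHodgeClasses`** (`(⟨x, y⟩_H : ℂ) = K_H(of x, of y)`),
  `andreFormHodgeClasses_comm` (SYMMETRIC: degree `2p` is even), `isRefl_andreFormHodgeClasses`;
  **def `kleimanFormHodgeClasses`** (`⟨x, ∗y⟩`), `coe_kleimanFormHodgeClasses`, `kleimanFormHodgeClasses_comm`, `isRefl_kleimanFormHodgeClasses`.
* §2 POLARIZED TORUS: **`IsRiemannForm.andreFormHodgeClasses_self_pos`** (`0 < sign_X(e)(−1)^g ⟨x, x⟩_H` in `ℚ` for `x ≠ 0`), **`IsRiemannForm.andreFormHodgeClasses_self_eq_zero_iff`**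
  (ANISOTROPIC), **`IsRiemannForm.restrict_andreFormHodgeClasses_nondegenerate`** (non-degenerate on EVERY subspace `A ≤ Hdgᵖ(X)`), `IsRiemannForm.andreFormHodgeClasses_nondegenerate`,
  **`IsRiemannForm.isCompl_orthogonal_andreFormHodgeClasses`** (`Hdgᵖ(X) = A ⊕ A^{⊥_H}` for every `ℚ`-subspace `A`); and the same five for Kleiman's form
  (`IsRiemannForm.kleimanFormHodgeClasses_self_pos`, `…_self_eq_zero_iff`, `IsRiemannForm.restrict_kleimanFormHodgeClasses_nondegenerate`, `…_nondegenerate`,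
  **`IsRiemannForm.isCompl_orthogonal_kleimanFormHodgeClasses`**).

## Sources, VERBATIM

* Y. André, *Pour une théorie inconditionnelle des motifs*, Publ. Math. IHÉS **83** (1996) [Andre1996Motifs] (held `paper:doi-10-1007-bf02698643`), §1.1 Remarque (p. 11 = p0008 L11–L14):
  "l'intérêt de l'introduction de `*_H` est que cet opérateur star et `*_H` ont les mêmes propriétés de positivité sur les cycles réels de type `(p,p)`"; Prop. 1.2 (p. 11):
  "la transposition relative à la forme bilinéaire `(x, y) ↦ ∫ x ∪ *y` […] pour `* = *_L` ou `*_H`".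
* S. L. Kleiman, *Algebraic cycles and the Weil conjectures* (1968) [Kleiman1968AlgebraicCycles], §3 (Hodge index / standard conjecture of Hodge type: "the form `(x, y) ↦ ⟨x, ⋆y⟩` is positive
  definite" up to sign on the primitive pieces; Cor. 3.11: semisimplicity of the algebra of correspondences from a positive involution).
* U. Jannsen, *Motives, numerical equivalence, and semi-simplicity*, Invent. Math. **107** (1992) [Jannsen1992] — cite-only: the orthogonal-complement mechanism behind semisimplicity.
* H. Lange, *Abelian Varieties over the Complex Numbers* (2023) [Lange2023AbelianVarietiesComplex], §7.2.2 (Hodge classes `H^{2p}(X, ℚ) ∩ H^{p,p}`), §5.4.1 Lemma 5.4.3 (d).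
* C. Voisin, *Hodge Theory and Complex Algebraic Geometry I* (CUP 2002) [VoisinHodgeI2002], §6.3.2 Thm. 6.32, §7.1.2.
-/

namespace Literature.Geometry.Kaehler

namespace ComplexTorus

open Module Function Finset
open Literature.LinearAlgebra.Alternating Literature.Algebra.Lie Literature.Analysis.Complex

set_option maxSynthPendingDepth 3

universe uE

variable {ι : Type*} [Fintype ι] [DecidableEq ι] {E : Type uE} [NormedAddCommGroup E] [NormedSpace ℂ E] [FiniteDimensional ℂ E]
  [Nontrivial E] (Φ : (ι → ℝ) ≃L[ℝ] E) {η : E [⋀^Fin 2]→L[ℝ] ℝ} {N : ℕ}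

/-! ## §1 The forms `⟨x, y⟩_H = B_e(x, *_H y)` and `⟨x, ∗y⟩` on `Hdgᵖ(X)` as `ℚ`-bilinear forms -/

section Definitions

/-- **The inclusion `Hdgᵖ(X) ↪ H•(X; ℂ)`, `x ↦ of (2p) x`, as a `ℚ`-linear map.** [cite: Lange2023AbelianVarietiesComplex, §7.2.2] -/
noncomputable def hodgeClassesToGForm (p : ℕ) : hodgeClasses Φ p →ₗ[ℚ] GForm E ℂ where
  toFun x := GForm.of (2 * p) (x : E [⋀^Fin (2 * p)]→L[ℝ] ℂ)
  map_add' x y := by rw [Submodule.coe_add, GForm.of_add]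
  map_smul' q x := by rw [Submodule.coe_smul, GForm.of_smul, RingHom.id_apply]

omit [Fintype ι] [DecidableEq ι] [FiniteDimensional ℂ E] [Nontrivial E] in
/-- Unfolding: `hodgeClassesToGForm Φ p x = of (2p) x`. [cite: Lange2023AbelianVarietiesComplex, §7.2.2] -/
@[simp] theorem hodgeClassesToGForm_apply (p : ℕ) (x : hodgeClasses Φ p) :
    hodgeClassesToGForm Φ p x = GForm.of (2 * p) (x : E [⋀^Fin (2 * p)]→L[ℝ] ℂ) := rfl

omit [Fintype ι] [DecidableEq ι] [FiniteDimensional ℂ E] [Nontrivial E] in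
/-- `Hdgᵖ(X) ↪ H•(X; ℂ)` is injective. [cite: Lange2023AbelianVarietiesComplex, §7.2.2] -/
theorem hodgeClassesToGForm_injective (p : ℕ) : Function.Injective (hodgeClassesToGForm Φ p) := by
  intro x y h
  apply Subtype.ext
  have h1 := congrArg (fun w : GForm E ℂ ↦ w (2 * p)) h
  simpa only [hodgeClassesToGForm_apply, GForm.of_apply_self] using h1

/-- **ANDRÉ'S FORM ON THE HODGE CLASSES: `⟨x, y⟩_H := B_e(of x, *_H (of y)) ∈ ℚ` for `x, y ∈ Hdgᵖ(X)`** — a `ℚ`-bilinear form on `Hdgᵖ(X) = H^{2p}(X; ℚ) ∩ H^{p,p}` (`η ∈ NS(X) ⊗ ℚ`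
non-degenerate; `*_H` André's Hodge involution of the Lefschetz `𝔰𝔩₂` of `η`, normalisation `d = g`; the values are rational by row g51-#5's
`compl₂_andreHodgeInvolution_of_of_mem_range_rat_of_mem_hodgeClasses`). [cite: Andre1996Motifs, §1.1 Remarque (p. 11) and Prop. 1.2 (p. 11, "la forme bilinéaire `(x, y) ↦ ∫ x ∪ *y`")]
[cite: Lange2023AbelianVarietiesComplex, §7.2.2] -/
noncomputable def andreFormHodgeClasses (hQ : η ∈ neronSeveriQ Φ) (hη : ∀ v : E, v ≠ 0 → ∃ w : E, η ![v, w] ≠ 0) (e : Fin N ≃ ι) (p : ℕ) :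
    LinearMap.BilinForm ℚ (hodgeClasses Φ p) :=
  LinearMap.restrictScalarsRange₂ (hodgeClassesToGForm Φ p) (hodgeClassesToGForm Φ p) (Algebra.linearMap ℚ ℂ) (algebraMap ℚ ℂ).injective
    ((poincarePairingG Φ e).compl₂ ((hasLefschetzProperty_lefschetzG hη).andreHodgeInvolution isZGrading_countingG (finrank ℂ E))) fun x y ↦ by
      obtain ⟨q, hq⟩ := compl₂_andreHodgeInvolution_of_of_mem_range_rat_of_mem_hodgeClasses Φ hQ hη e x.2 y.2
      exact ⟨q, by rw [Algebra.linearMap_apply, eq_ratCast, ← hq, hodgeClassesToGForm_apply, hodgeClassesToGForm_apply]⟩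

/-- **`(⟨x, y⟩_H : ℂ) = K_H(of x, of y)`.** [cite: Andre1996Motifs, Prop. 1.2 (p. 11)] -/
theorem coe_andreFormHodgeClasses (hQ : η ∈ neronSeveriQ Φ) (hη : ∀ v : E, v ≠ 0 → ∃ w : E, η ![v, w] ≠ 0) (e : Fin N ≃ ι) {p : ℕ}
    (x y : hodgeClasses Φ p) :
    ((andreFormHodgeClasses Φ hQ hη e p x y : ℚ) : ℂ) =
      (poincarePairingG Φ e).compl₂ ((hasLefschetzProperty_lefschetzG hη).andreHodgeInvolution isZGrading_countingG (finrank ℂ E))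
        (GForm.of (2 * p) (x : E [⋀^Fin (2 * p)]→L[ℝ] ℂ)) (GForm.of (2 * p) (y : E [⋀^Fin (2 * p)]→L[ℝ] ℂ)) := by
  have h1 := LinearMap.restrictScalarsRange₂_apply (hodgeClassesToGForm Φ p) (hodgeClassesToGForm Φ p) (Algebra.linearMap ℚ ℂ) (algebraMap ℚ ℂ).injective
    ((poincarePairingG Φ e).compl₂ ((hasLefschetzProperty_lefschetzG hη).andreHodgeInvolution isZGrading_countingG (finrank ℂ E))) (fun x y ↦ by
      obtain ⟨q, hq⟩ := compl₂_andreHodgeInvolution_of_of_mem_range_rat_of_mem_hodgeClasses Φ hQ hη e x.2 y.2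
      exact ⟨q, by rw [Algebra.linearMap_apply, eq_ratCast, ← hq, hodgeClassesToGForm_apply, hodgeClassesToGForm_apply]⟩) x y
  rw [Algebra.linearMap_apply, eq_ratCast, hodgeClassesToGForm_apply, hodgeClassesToGForm_apply] at h1
  exact h1

/-- **`⟨·,·⟩_H` IS SYMMETRIC: `⟨x, y⟩_H = ⟨y, x⟩_H`** (`K_H` is `(−1)ᵏ`-symmetric on `Hᵏ`, row g51-#5, and `k = 2p` is even). [cite: Andre1996Motifs, §1.1 Remarque (p. 11)]
[cite: Kleiman1968AlgebraicCycles, §3] -/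
theorem andreFormHodgeClasses_comm (hQ : η ∈ neronSeveriQ Φ) (hη : ∀ v : E, v ≠ 0 → ∃ w : E, η ![v, w] ≠ 0) (e : Fin N ≃ ι) {p : ℕ}
    (x y : hodgeClasses Φ p) : andreFormHodgeClasses Φ hQ hη e p x y = andreFormHodgeClasses Φ hQ hη e p y x := by
  apply Rat.cast_injective (α := ℂ)
  rw [coe_andreFormHodgeClasses, coe_andreFormHodgeClasses, compl₂_andreHodgeInvolution_of_of_comm Φ hη e (finrank ℂ E), pow_mul, neg_one_sq, one_pow, one_mul]

/-- `⟨·,·⟩_H` is reflexive. [cite: Andre1996Motifs, §1.1 Remarque (p. 11)] -/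
theorem isRefl_andreFormHodgeClasses (hQ : η ∈ neronSeveriQ Φ) (hη : ∀ v : E, v ≠ 0 → ∃ w : E, η ![v, w] ≠ 0) (e : Fin N ≃ ι) (p : ℕ) :
    (andreFormHodgeClasses Φ hQ hη e p).IsRefl := fun x y h ↦ by
  rw [andreFormHodgeClasses_comm]; exact h

/-- **KLEIMAN'S FORM ON THE HODGE CLASSES: `⟨x, ∗y⟩ := B_e(of x, ∗(of y)) ∈ ℚ`** (Kleiman–Milne's `∗`, normalisation `d = g`; rational values by row g51-#3).
[cite: Kleiman1968AlgebraicCycles, §1.4 (1.4.2) and §3] [cite: Lange2023AbelianVarietiesComplex, §7.2.2] -/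
noncomputable def kleimanFormHodgeClasses (hNS : IsNSForm Φ η) (hη : ∀ v : E, v ≠ 0 → ∃ w : E, η ![v, w] ≠ 0) (e : Fin N ≃ ι) (p : ℕ) :
    LinearMap.BilinForm ℚ (hodgeClasses Φ p) :=
  LinearMap.restrictScalarsRange₂ (hodgeClassesToGForm Φ p) (hodgeClassesToGForm Φ p) (Algebra.linearMap ℚ ℂ) (algebraMap ℚ ℂ).injective
    ((poincarePairingG Φ e).compl₂ ((hasLefschetzProperty_lefschetzG hη).hodgeInvolution isZGrading_countingG (finrank ℂ E))) fun x y ↦ by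
      obtain ⟨q, hq⟩ := hNS.compl₂_hodgeInvolution_of_of_mem_range_rat_of_mem_hodgeClasses Φ hη e x.2 y.2
      exact ⟨q, by rw [Algebra.linearMap_apply, eq_ratCast, ← hq, hodgeClassesToGForm_apply, hodgeClassesToGForm_apply]⟩

/-- **`(⟨x, ∗y⟩ : ℂ) = K_∗(of x, of y)`.** [cite: Kleiman1968AlgebraicCycles, §1.4 (1.4.2)] -/
theorem coe_kleimanFormHodgeClasses (hNS : IsNSForm Φ η) (hη : ∀ v : E, v ≠ 0 → ∃ w : E, η ![v, w] ≠ 0) (e : Fin N ≃ ι) {p : ℕ}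
    (x y : hodgeClasses Φ p) :
    ((kleimanFormHodgeClasses Φ hNS hη e p x y : ℚ) : ℂ) =
      (poincarePairingG Φ e).compl₂ ((hasLefschetzProperty_lefschetzG hη).hodgeInvolution isZGrading_countingG (finrank ℂ E))
        (GForm.of (2 * p) (x : E [⋀^Fin (2 * p)]→L[ℝ] ℂ)) (GForm.of (2 * p) (y : E [⋀^Fin (2 * p)]→L[ℝ] ℂ)) := by
  have h1 := LinearMap.restrictScalarsRange₂_apply (hodgeClassesToGForm Φ p) (hodgeClassesToGForm Φ p) (Algebra.linearMap ℚ ℂ) (algebraMap ℚ ℂ).injective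
    ((poincarePairingG Φ e).compl₂ ((hasLefschetzProperty_lefschetzG hη).hodgeInvolution isZGrading_countingG (finrank ℂ E))) (fun x y ↦ by
      obtain ⟨q, hq⟩ := hNS.compl₂_hodgeInvolution_of_of_mem_range_rat_of_mem_hodgeClasses Φ hη e x.2 y.2
      exact ⟨q, by rw [Algebra.linearMap_apply, eq_ratCast, ← hq, hodgeClassesToGForm_apply, hodgeClassesToGForm_apply]⟩) x y
  rw [Algebra.linearMap_apply, eq_ratCast, hodgeClassesToGForm_apply, hodgeClassesToGForm_apply] at h1
  exact h1

/-- **Kleiman's form on `Hdgᵖ(X)` is symmetric.** [cite: Kleiman1968AlgebraicCycles, §3] -/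
theorem kleimanFormHodgeClasses_comm (hNS : IsNSForm Φ η) (hη : ∀ v : E, v ≠ 0 → ∃ w : E, η ![v, w] ≠ 0) (e : Fin N ≃ ι) {p : ℕ}
    (x y : hodgeClasses Φ p) : kleimanFormHodgeClasses Φ hNS hη e p x y = kleimanFormHodgeClasses Φ hNS hη e p y x := by
  apply Rat.cast_injective (α := ℂ)
  rw [coe_kleimanFormHodgeClasses, coe_kleimanFormHodgeClasses,
    compl₂_hodgeInvolution_apply_of_comm Φ hη e (finrank ℂ E) (y : E [⋀^Fin (2 * p)]→L[ℝ] ℂ) (GForm.of (2 * p) (x : E [⋀^Fin (2 * p)]→L[ℝ] ℂ)),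
    pow_mul, neg_one_sq, one_pow, one_mul]

/-- Kleiman's form on `Hdgᵖ(X)` is reflexive. [cite: Kleiman1968AlgebraicCycles, §3] -/
theorem isRefl_kleimanFormHodgeClasses (hNS : IsNSForm Φ η) (hη : ∀ v : E, v ≠ 0 → ∃ w : E, η ![v, w] ≠ 0) (e : Fin N ≃ ι) (p : ℕ) :
    (kleimanFormHodgeClasses Φ hNS hη e p).IsRefl := fun x y h ↦ by
  rw [kleimanFormHodgeClasses_comm]; exact h

end Definitions

/-! ## §2 On a polarized torus: definite up to `sign_X(e)(−1)^g`, anisotropic, non-degenerate on every subspace, orthogonal complements -/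

section Polarized

/-- **`0 < sign_X(e) · (−1)^g · ⟨x, x⟩_H` IN `ℚ` for every non-zero Hodge class `x ∈ Hdgᵖ(X)`** of a polarized complex torus (`η` a Riemann form, `e : Fin (2g) ≃ ι`): André's form on
the Hodge classes is DEFINITE up to the orientation sign (row g51-#5 `IsRiemannForm.exists_pos_rat_orientationSign_mul_compl₂_andreHodgeInvolution_of_mem_hodgeClasses`).
[cite: Andre1996Motifs, §1.1 Remarque (p. 11)] [cite: Kleiman1968AlgebraicCycles, §3] [cite: VoisinHodgeI2002, §6.3.2 Thm. 6.32] -/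
theorem IsRiemannForm.andreFormHodgeClasses_self_pos (hR : IsRiemannForm Φ η) {g : ℕ} (e : Fin (2 * g) ≃ ι) {p : ℕ} {x : hodgeClasses Φ p} (hx0 : x ≠ 0) :
    0 < orientationSign Φ e * (-1 : ℚ) ^ g *
      andreFormHodgeClasses Φ (mem_neronSeveriQ_of_isNSForm Φ (hR.isNSForm Φ)) (hR.exists_apply_ne_zero Φ) e p x x := by
  have hg : finrank ℂ E = g := finrank_eq_of_finTwoMulEquiv Φ e
  have hx0' : (x : E [⋀^Fin (2 * p)]→L[ℝ] ℂ) ≠ 0 := fun h ↦ hx0 (Subtype.ext h)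
  obtain ⟨q, hq, hqx⟩ := hR.exists_pos_rat_orientationSign_mul_compl₂_andreHodgeInvolution_of_mem_hodgeClasses Φ e x.2 hx0'
  subst hg
  have h1 : orientationSign Φ e * (-1 : ℚ) ^ finrank ℂ E *
      andreFormHodgeClasses Φ (mem_neronSeveriQ_of_isNSForm Φ (hR.isNSForm Φ)) (hR.exists_apply_ne_zero Φ) e p x x = q := by
    apply Rat.cast_injective (α := ℂ)
    push_cast
    rw [coe_andreFormHodgeClasses]
    exact hqx
  rw [h1]
  exact hq

/-- **`⟨x, x⟩_H = 0 ↔ x = 0` on `Hdgᵖ(X)`** (polarized torus): André's form on the Hodge classes is ANISOTROPIC. [cite: Andre1996Motifs, §1.1 Remarque (p. 11)] [cite: Kleiman1968AlgebraicCycles, §3] -/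
theorem IsRiemannForm.andreFormHodgeClasses_self_eq_zero_iff (hR : IsRiemannForm Φ η) {g : ℕ} (e : Fin (2 * g) ≃ ι) {p : ℕ} (x : hodgeClasses Φ p) :
    andreFormHodgeClasses Φ (mem_neronSeveriQ_of_isNSForm Φ (hR.isNSForm Φ)) (hR.exists_apply_ne_zero Φ) e p x x = 0 ↔ x = 0 := by
  refine ⟨fun h0 ↦ by_contra fun hx0 ↦ ?_, fun h ↦ by rw [h, map_zero]⟩
  have h1 := hR.andreFormHodgeClasses_self_pos Φ e (p := p) hx0
  rw [h0, mul_zero] at h1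
  exact lt_irrefl _ h1

/-- **`⟨·,·⟩_H` IS NON-DEGENERATE ON EVERY `ℚ`-SUBSPACE `A ≤ Hdgᵖ(X)`** (polarized torus): an anisotropic form restricts to a non-degenerate one on each subspace.
[cite: Andre1996Motifs, §1.1 Remarque (p. 11)] [cite: Kleiman1968AlgebraicCycles, §3 Cor. 3.11] -/
theorem IsRiemannForm.restrict_andreFormHodgeClasses_nondegenerate (hR : IsRiemannForm Φ η) {g : ℕ} (e : Fin (2 * g) ≃ ι) {p : ℕ}
    (A : Submodule ℚ (hodgeClasses Φ p)) :
    ((andreFormHodgeClasses Φ (mem_neronSeveriQ_of_isNSForm Φ (hR.isNSForm Φ)) (hR.exists_apply_ne_zero Φ) e p).restrict A).Nondegenerate := by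
  refine ⟨fun x hx ↦ ?_, fun y hy ↦ ?_⟩
  · have h1 := hx x
    rw [LinearMap.BilinForm.restrict_apply, LinearMap.domRestrict_apply] at h1
    exact Subtype.ext ((hR.andreFormHodgeClasses_self_eq_zero_iff Φ e (x : hodgeClasses Φ p)).1 h1)
  · have h1 := hy y
    rw [LinearMap.BilinForm.restrict_apply, LinearMap.domRestrict_apply] at h1
    exact Subtype.ext ((hR.andreFormHodgeClasses_self_eq_zero_iff Φ e (y : hodgeClasses Φ p)).1 h1)

/-- **`⟨·,·⟩_H` IS NON-DEGENERATE ON `Hdgᵖ(X)`** (polarized torus). [cite: Andre1996Motifs, §1.1 Remarque and Prop. 1.2 (p. 11)] [cite: Kleiman1968AlgebraicCycles, §3] -/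
theorem IsRiemannForm.andreFormHodgeClasses_nondegenerate (hR : IsRiemannForm Φ η) {g : ℕ} (e : Fin (2 * g) ≃ ι) (p : ℕ) :
    (andreFormHodgeClasses Φ (mem_neronSeveriQ_of_isNSForm Φ (hR.isNSForm Φ)) (hR.exists_apply_ne_zero Φ) e p).Nondegenerate := by
  refine ⟨fun x hx ↦ ?_, fun y hy ↦ ?_⟩
  · exact (hR.andreFormHodgeClasses_self_eq_zero_iff Φ e x).1 (hx x)
  · exact (hR.andreFormHodgeClasses_self_eq_zero_iff Φ e y).1 (hy y)

/-- **EVERY `ℚ`-SUBSPACE OF HODGE CLASSES HAS ITS ANDRÉ-ORTHOGONAL COMPLEMENT: `Hdgᵖ(X) = A ⊕ A^{⊥_H}`** (`IsCompl A (⟨·,·⟩_H.orthogonal A)`) for every `A ≤ Hdgᵖ(X)` of a polarized complex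
torus — the mechanism behind the semisimplicity statements drawn from a definite form `⟨x, *y⟩` (`dim_ℚ Hdgᵖ(X) < ∞`, Mathlib's `isCompl_orthogonal_of_restrict_nondegenerate`).
[cite: Andre1996Motifs, §1.1 Remarque and Prop. 1.2 (p. 11)] [cite: Kleiman1968AlgebraicCycles, §3 Cor. 3.11] [cite: Jannsen1992, Thm. 1 (proof: the orthogonal complement for a non-degenerate symmetric form)] -/
theorem IsRiemannForm.isCompl_orthogonal_andreFormHodgeClasses (hR : IsRiemannForm Φ η) {g : ℕ} (e : Fin (2 * g) ≃ ι) {p : ℕ}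
    (A : Submodule ℚ (hodgeClasses Φ p)) :
    IsCompl A ((andreFormHodgeClasses Φ (mem_neronSeveriQ_of_isNSForm Φ (hR.isNSForm Φ)) (hR.exists_apply_ne_zero Φ) e p).orthogonal A) := by
  haveI : FiniteDimensional ℚ (hodgeClasses Φ p) := finiteDimensional_hodgeClassesIn Φ (2 * p) p
  exact LinearMap.BilinForm.isCompl_orthogonal_of_restrict_nondegenerate (isRefl_andreFormHodgeClasses Φ _ _ e p)
    (hR.restrict_andreFormHodgeClasses_nondegenerate Φ e A)

/-- **`0 < sign_X(e) · (−1)^g · ⟨x, ∗x⟩` IN `ℚ` for every non-zero Hodge class `x`** (polarized torus; Kleiman's `∗`, row g51-#6).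
[cite: Kleiman1968AlgebraicCycles, §1.4 and §3] [cite: Andre1996Motifs, §1.1 Remarque (p. 11)] -/
theorem IsRiemannForm.kleimanFormHodgeClasses_self_pos (hR : IsRiemannForm Φ η) {g : ℕ} (e : Fin (2 * g) ≃ ι) {p : ℕ} {x : hodgeClasses Φ p} (hx0 : x ≠ 0) :
    0 < orientationSign Φ e * (-1 : ℚ) ^ g * kleimanFormHodgeClasses Φ (hR.isNSForm Φ) (hR.exists_apply_ne_zero Φ) e p x x := by
  have hg : finrank ℂ E = g := finrank_eq_of_finTwoMulEquiv Φ e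
  have hx0' : (x : E [⋀^Fin (2 * p)]→L[ℝ] ℂ) ≠ 0 := fun h ↦ hx0 (Subtype.ext h)
  obtain ⟨q, hq, hqx⟩ := hR.exists_pos_rat_orientationSign_mul_compl₂_hodgeInvolution_of_mem_hodgeClasses Φ e x.2 hx0'
  subst hg
  have h1 : orientationSign Φ e * (-1 : ℚ) ^ finrank ℂ E * kleimanFormHodgeClasses Φ (hR.isNSForm Φ) (hR.exists_apply_ne_zero Φ) e p x x = q := by
    apply Rat.cast_injective (α := ℂ)
    push_cast
    rw [coe_kleimanFormHodgeClasses]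
    exact hqx
  rw [h1]
  exact hq

/-- **`⟨x, ∗x⟩ = 0 ↔ x = 0` on `Hdgᵖ(X)`** (polarized torus). [cite: Kleiman1968AlgebraicCycles, §3] -/
theorem IsRiemannForm.kleimanFormHodgeClasses_self_eq_zero_iff (hR : IsRiemannForm Φ η) {g : ℕ} (e : Fin (2 * g) ≃ ι) {p : ℕ} (x : hodgeClasses Φ p) :
    kleimanFormHodgeClasses Φ (hR.isNSForm Φ) (hR.exists_apply_ne_zero Φ) e p x x = 0 ↔ x = 0 := by
  refine ⟨fun h0 ↦ by_contra fun hx0 ↦ ?_, fun h ↦ by rw [h, map_zero]⟩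
  have h1 := hR.kleimanFormHodgeClasses_self_pos Φ e (p := p) hx0
  rw [h0, mul_zero] at h1
  exact lt_irrefl _ h1

/-- **Kleiman's form is non-degenerate on every `ℚ`-subspace `A ≤ Hdgᵖ(X)`** (polarized torus). [cite: Kleiman1968AlgebraicCycles, §3 Cor. 3.11] -/
theorem IsRiemannForm.restrict_kleimanFormHodgeClasses_nondegenerate (hR : IsRiemannForm Φ η) {g : ℕ} (e : Fin (2 * g) ≃ ι) {p : ℕ}
    (A : Submodule ℚ (hodgeClasses Φ p)) :
    ((kleimanFormHodgeClasses Φ (hR.isNSForm Φ) (hR.exists_apply_ne_zero Φ) e p).restrict A).Nondegenerate := by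
  refine ⟨fun x hx ↦ ?_, fun y hy ↦ ?_⟩
  · have h1 := hx x
    rw [LinearMap.BilinForm.restrict_apply, LinearMap.domRestrict_apply] at h1
    exact Subtype.ext ((hR.kleimanFormHodgeClasses_self_eq_zero_iff Φ e (x : hodgeClasses Φ p)).1 h1)
  · have h1 := hy y
    rw [LinearMap.BilinForm.restrict_apply, LinearMap.domRestrict_apply] at h1
    exact Subtype.ext ((hR.kleimanFormHodgeClasses_self_eq_zero_iff Φ e (y : hodgeClasses Φ p)).1 h1)

/-- **Kleiman's form is non-degenerate on `Hdgᵖ(X)`** (polarized torus). [cite: Kleiman1968AlgebraicCycles, §3] -/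
theorem IsRiemannForm.kleimanFormHodgeClasses_nondegenerate (hR : IsRiemannForm Φ η) {g : ℕ} (e : Fin (2 * g) ≃ ι) (p : ℕ) :
    (kleimanFormHodgeClasses Φ (hR.isNSForm Φ) (hR.exists_apply_ne_zero Φ) e p).Nondegenerate := by
  refine ⟨fun x hx ↦ ?_, fun y hy ↦ ?_⟩
  · exact (hR.kleimanFormHodgeClasses_self_eq_zero_iff Φ e x).1 (hx x)
  · exact (hR.kleimanFormHodgeClasses_self_eq_zero_iff Φ e y).1 (hy y)

/-- **`Hdgᵖ(X) = A ⊕ A^{⊥_∗}` for every `ℚ`-subspace `A`** (polarized torus; Kleiman's form). [cite: Kleiman1968AlgebraicCycles, §3 Cor. 3.11]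
[cite: Jannsen1992, Thm. 1 (proof)] -/
theorem IsRiemannForm.isCompl_orthogonal_kleimanFormHodgeClasses (hR : IsRiemannForm Φ η) {g : ℕ} (e : Fin (2 * g) ≃ ι) {p : ℕ}
    (A : Submodule ℚ (hodgeClasses Φ p)) :
    IsCompl A ((kleimanFormHodgeClasses Φ (hR.isNSForm Φ) (hR.exists_apply_ne_zero Φ) e p).orthogonal A) := by
  haveI : FiniteDimensional ℚ (hodgeClasses Φ p) := finiteDimensional_hodgeClassesIn Φ (2 * p) p
  exact LinearMap.BilinForm.isCompl_orthogonal_of_restrict_nondegenerate (isRefl_kleimanFormHodgeClasses Φ _ _ e p)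
    (hR.restrict_kleimanFormHodgeClasses_nondegenerate Φ e A)

end Polarized

end ComplexTorus

end Literature.Geometry.Kaehler
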